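import Literature.Analysis.FluidPDE.AxisymNoSwirlVorticity
import Literature.Analysis.FluidPDE.MeridianReduction
import Mathlib.Analysis.InnerProductSpace.Calculus
import Mathlib.Analysis.Calculus.MeanValue
import Mathlib.Analysis.Convex.Topology
import HarnessLib

/-!
# The `SO(4)`-invariant lift of an axisymmetric scalar to `ℝ⁵` (KNSS 2009, §5, p. 9)

Analysis/FluidPDE support file on the decomposition path of the named fact
`Literature.Analysis.FluidPDE.KNSS2009_liouville_axisymmetric_no_swirl` (Koch–Nadirashvili–
Seregin–Šverák, Acta Math. 203 (2009) = arXiv:0709.3599, Theorem 5.2). In the proof of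
Theorem 5.2 the scalar `f = ω_θ / r` of an axisymmetric swirl-free flow satisfies
`fₜ + u_r f_r + u_z f_z = Δf + (2/r) f_r` ((5.10)), and KNSS observe (p. 9): "The diffusion term
… can be interpreted as the 5-dimensional Laplacian acting on SO(4)-invariant functions in
`ℝ⁵`. We write `r = √(y₁² + ⋯ + y₄²)`, `y₅ = z` and note that for `f̃(y₁, …, y₅) = f(r, z)` we
have `Δ_y f̃ = f_rr + (3/r) f_r + f_zz`. […] Lemma 2.1 can be applied."

This file makes the lift `f ↦ f̃` precise and proves what Lemma 2.1 needs of it: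

* `horizProj` (`P y = (y₀, …, y₃, 0)`), `axisPt y = (|P y|, 0, y₄) ∈ ℝ³`, `liftAx g y = g (axisPt y)`.
* Parity bookkeeping on `ℝ³`: the coordinate reflections `reflC i`, `IsEvenC i`/`IsOddC i`;
  an axisymmetric scalar is even in `x₀` and `x₁` (`IsAxisymmetricScalar.isEvenC_zero/one`),
  derivatives flip parity, odd functions vanish on the mirror, the Hadamard quotient
  (`hadamardQuotFst`) of an odd function is even.
* `hasFDerivAt_of_hasFDerivAt_off_ker`: a continuous function, differentiable off the kernel
  of a linear map with a derivative extending continuously, is differentiable on the kernel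
  (mean value inequality on segments + closure) — this handles the axis `{P y = 0}`.
* `hasFDerivAt_liftAx`: for `g ∈ C²` with `∂₀g = 0` on `{x₀ = 0}`,
  `D(liftAx g)(y) = q(axisPt y) ⟪P y, ·⟫ + ∂₂g(axisPt y) (·)₄`, `q = hadamardQuotFst ∂₀g`
  (`liftDeriv`); `contDiff_one_liftAx`; `contDiff_two_liftAx` for `g ∈ C⁴` even in `x₀`.
* `laplacian_liftAx`: `Δ(liftAx g)(y) = ∂₀∂₀g + ∂₂∂₂g + 3q` at `axisPt y` (all `y`, axis included),
  and `r² Δ(liftAx g)(y) = r² Δ_{ℝ³} g + 2 (x₀∂₀g + x₁∂₁g)` at `x = axisPt y` for axisymmetric `g`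
  (`sq_mul_laplacian_liftAx`: KNSS's `f_rr + (3/r) f_r + f_zz = Δ_{ℝ³} f + (2/r) f_r`); the drift
  identity `D(liftAx g)(y)[u_r P y/|P y| + u_z e₄] = Dg(axisPt y)[u]` (`liftDeriv_apply_drift`);
  sup bounds (`norm_liftDeriv_le`, `abs_laplacian_liftAx_le`); continuity in parameters
  (`continuous_liftDeriv_param`, `continuous_laplacian_liftAx_param`).

All statements are folklore calculus; nothing here is specific to Navier–Stokes.

## References

* G. Koch, N. Nadirashvili, G. Seregin, V. Šverák, *Liouville theorems for the Navier–Stokes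
  equations and applications*, Acta Math. 203 (2009) = arXiv:0709.3599, §5, (5.10)–(5.12) and
  the paragraph before Theorem 5.2, p. 9. [KochNadirashviliSereginSverak2009]
-/

noncomputable section

open Set Function Filter Topology WithLp MeasureTheory
open scoped RealInnerProductSpace Topology ContDiff Laplacian

namespace Literature.Analysis.FluidPDE

/-- Local notation for `ℝ³ = EuclideanSpace ℝ (Fin 3)`. -/
local notation "ℝ³" => EuclideanSpace ℝ (Fin 3)
/-- Local notation for `ℝ⁵ = EuclideanSpace ℝ (Fin 5)`. -/
local notation "ℝ⁵" => EuclideanSpace ℝ (Fin 5)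

/-! ### Differentiability across the kernel of a linear map -/

section Extension

variable {E E' G : Type*} [NormedAddCommGroup E] [NormedSpace ℝ E] [NormedAddCommGroup E']
  [NormedSpace ℝ E'] [NormedAddCommGroup G] [NormedSpace ℝ G]

/-- **Differentiability across the kernel of a linear map from a continuous extension of the
derivative.** Let `P` be a continuous linear map with `P ≠ 0`, `f` continuous, differentiable at
every `z` with `P z ≠ 0` with derivative `L z`, and `L` continuous at a point `y` of the kernel.
Then `f` is differentiable at `y` with derivative `L y` (mean value inequality on segments
`(y, y + h]`, which avoid the kernel when `P h ≠ 0`, extended to all `h` by closedness). [folklore] -/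
theorem hasFDerivAt_of_hasFDerivAt_off_ker (P : E →L[ℝ] E') {f : E → G} {L : E → E →L[ℝ] G}
    {y : E} (hf : Continuous f) (hL : ContinuousAt L y) (hy : P y = 0) (hP : ∃ v, P v ≠ 0)
    (hd : ∀ z, P z ≠ 0 → HasFDerivAt f (L z) z) : HasFDerivAt f (L y) y := by
  rw [hasFDerivAt_iff_isLittleO_nhds_zero, Asymptotics.isLittleO_iff]
  intro ε hε
  obtain ⟨δ, hδ, hLδ⟩ : ∃ δ > 0, ∀ z, dist z y < δ → dist (L z) (L y) < ε :=
    Metric.continuousAt_iff.1 hL ε hε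
  have hLy : Continuous fun v => L y v := (L y).continuous
  -- the estimate for increments transversal to the kernel
  have key : ∀ h, P h ≠ 0 → ‖h‖ < δ → ‖f (y + h) - f y - L y h‖ ≤ ε * ‖h‖ := by
    intro h hPh hhδ
    set s := openSegment ℝ y (y + h) with hs_def
    have hs : Convex ℝ s := convex_openSegment y (y + h)
    have hmem : ∀ z ∈ s, ∃ t ∈ Ioo (0 : ℝ) 1, z = y + t • h := by
      intro z hz
      rw [hs_def, openSegment_eq_image'] at hz
      obtain ⟨t, ht, rfl⟩ := hz
      exact ⟨t, ht, by rw [add_sub_cancel_left]⟩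
    have hderiv : ∀ z ∈ s, HasFDerivWithinAt f (L z) s z := by
      intro z hz
      obtain ⟨t, ht, rfl⟩ := hmem z hz
      refine (hd _ ?_).hasFDerivWithinAt
      rw [map_add, hy, zero_add, map_smul]
      exact smul_ne_zero ht.1.ne' hPh
    have hbound : ∀ z ∈ s, ‖L z - L y‖ ≤ ε := by
      intro z hz
      obtain ⟨t, ht, rfl⟩ := hmem z hz
      rw [← dist_eq_norm]
      refine (hLδ _ ?_).le
      rw [dist_eq_norm, add_sub_cancel_left, norm_smul, Real.norm_eq_abs, abs_of_pos ht.1]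
      calc t * ‖h‖ ≤ 1 * ‖h‖ := by gcongr; exact ht.2.le
        _ < δ := by rw [one_mul]; exact hhδ
    have mvt : s ×ˢ s ⊆ {p : E × E | ‖f p.2 - f p.1 - L y (p.2 - p.1)‖ ≤ ε * ‖p.2 - p.1‖} :=
      fun p hp => hs.norm_image_sub_le_of_norm_hasFDerivWithin_le' hderiv hbound hp.1 hp.2
    have hclosed : IsClosed {p : E × E | ‖f p.2 - f p.1 - L y (p.2 - p.1)‖ ≤ ε * ‖p.2 - p.1‖} :=
      isClosed_le (by fun_prop) (by fun_prop)
    have hcl : (y, y + h) ∈ closure (s ×ˢ s) := by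
      rw [closure_prod_eq, hs_def, closure_openSegment]
      exact ⟨left_mem_segment ℝ y (y + h), right_mem_segment ℝ y (y + h)⟩
    have := hclosed.closure_subset_iff.2 mvt hcl
    simpa only [mem_setOf_eq, add_sub_cancel_left] using this
  -- extension to all small increments by closedness
  obtain ⟨v, hv⟩ := hP
  have hA : IsClosed {h : E | ‖f (y + h) - f y - L y h‖ ≤ ε * ‖h‖} :=
    isClosed_le (by fun_prop) (by fun_prop)
  filter_upwards [Metric.ball_mem_nhds (0 : E) hδ] with h hh
  rw [Metric.mem_ball, dist_zero_right] at hh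
  by_cases hPh : P h = 0
  swap
  · exact key h hPh hh
  have htend : Tendsto (fun t : ℝ => h + t • v) (𝓝[≠] 0) (𝓝 h) := by
    have hc : Continuous fun t : ℝ => h + t • v := by fun_prop
    have := hc.tendsto 0
    rw [zero_smul, add_zero] at this
    exact this.mono_left nhdsWithin_le_nhds
  refine hA.mem_of_tendsto htend ?_
  have h1 : ∀ᶠ t : ℝ in 𝓝[≠] 0, ‖h + t • v‖ < δ := by
    have hc : Continuous fun t : ℝ => ‖h + t • v‖ := by fun_prop
    have h0 : ‖h + (0 : ℝ) • v‖ < δ := by rwa [zero_smul, add_zero]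
    exact ((hc.tendsto 0).eventually (Iio_mem_nhds h0)).filter_mono nhdsWithin_le_nhds
  filter_upwards [h1, self_mem_nhdsWithin] with t ht1 (ht2 : t ≠ 0)
  refine key _ ?_ ht1
  rw [map_add, hPh, zero_add, map_smul]
  exact smul_ne_zero ht2 hv

/-- **Density of the complement of a proper kernel**: if `P v ≠ 0` for some `v`, two continuous
functions that agree off the kernel of `P` agree everywhere. [folklore] -/
theorem eq_of_eq_off_ker {X : Type*} [TopologicalSpace X] [T2Space X] (P : E →L[ℝ] E')
    (hP : ∃ v, P v ≠ 0) {g₁ g₂ : E → X} (h₁ : Continuous g₁) (h₂ : Continuous g₂)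
    (h : ∀ z, P z ≠ 0 → g₁ z = g₂ z) (y : E) : g₁ y = g₂ y := by
  by_cases hy : P y = 0
  swap
  · exact h y hy
  obtain ⟨v, hv⟩ := hP
  have htend : Tendsto (fun t : ℝ => y + t • v) (𝓝[≠] 0) (𝓝 y) := by
    have hc : Continuous fun t : ℝ => y + t • v := by fun_prop
    have := hc.tendsto 0
    rw [zero_smul, add_zero] at this
    exact this.mono_left nhdsWithin_le_nhds
  have hev : ∀ᶠ t : ℝ in 𝓝[≠] 0, g₁ (y + t • v) = g₂ (y + t • v) := by
    filter_upwards [self_mem_nhdsWithin] with t (ht : t ≠ 0)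
    refine h _ ?_
    rw [map_add, hy, zero_add, map_smul]
    exact smul_ne_zero ht hv
  exact tendsto_nhds_unique_of_eventuallyEq ((h₁.tendsto y).comp htend) ((h₂.tendsto y).comp htend)
    hev

end Extension

/-! ### Coordinate reflections of `ℝ³` and parity -/

section Reflection

/-- The reflection of `ℝ³` in the `i`-th coordinate: `(reflC i x)ᵢ = −xᵢ`, the other coordinates
unchanged. [folklore] -/
def reflC (i : Fin 3) : ℝ³ →L[ℝ] ℝ³ :=
  ContinuousLinearMap.id ℝ ℝ³ -
    (2 : ℝ) • (EuclideanSpace.proj i : ℝ³ →L[ℝ] ℝ).smulRight (EuclideanSpace.single i (1 : ℝ))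

/-- Coordinates of the reflection. [folklore] -/
theorem reflC_apply (i : Fin 3) (x : ℝ³) (j : Fin 3) :
    reflC i x j = if j = i then -x j else x j := by
  simp [reflC, PiLp.single_apply]
  split_ifs with h
  · subst h; ring
  · ring

/-- The reflected coordinate changes sign. [folklore] -/
@[simp] theorem reflC_apply_same (i : Fin 3) (x : ℝ³) : reflC i x i = -x i := by
  rw [reflC_apply, if_pos rfl]

/-- The other coordinates are unchanged. [folklore] -/
theorem reflC_apply_of_ne {i j : Fin 3} (h : j ≠ i) (x : ℝ³) : reflC i x j = x j := by
  rw [reflC_apply, if_neg h]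

/-- A reflection is an involution. [folklore] -/
@[simp] theorem reflC_reflC (i : Fin 3) (x : ℝ³) : reflC i (reflC i x) = x := by
  ext j
  rw [reflC_apply, reflC_apply]
  split_ifs <;> ring

/-- The reflection negates its coordinate vector. [folklore] -/
theorem reflC_single_same (i : Fin 3) :
    reflC i (EuclideanSpace.single i (1 : ℝ)) = -EuclideanSpace.single i (1 : ℝ) := by
  ext j
  rw [reflC_apply, PiLp.neg_apply, PiLp.single_apply]
  split_ifs <;> simp

/-- The reflection fixes the other coordinate vectors. [folklore] -/
theorem reflC_single_of_ne {i k : Fin 3} (h : k ≠ i) :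
    reflC i (EuclideanSpace.single k (1 : ℝ)) = EuclideanSpace.single k (1 : ℝ) := by
  ext j
  rw [reflC_apply, PiLp.single_apply]
  split_ifs with h1 h2
  · exact absurd (h2.symm.trans h1) h
  · simp
  · rfl
  · rfl

/-- Points of the mirror `{xᵢ = 0}` are fixed. [folklore] -/
theorem reflC_eq_self {i : Fin 3} {x : ℝ³} (hx : x i = 0) : reflC i x = x := by
  ext j
  rw [reflC_apply]
  split_ifs with h
  · rw [h, hx, neg_zero]
  · rfl

variable {F : Type*} [NormedAddCommGroup F] [NormedSpace ℝ F]

/-- `w` is even in the `i`-th coordinate. [folklore] -/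
def IsEvenC (i : Fin 3) (w : ℝ³ → F) : Prop :=
  ∀ x, w (reflC i x) = w x

/-- `w` is odd in the `i`-th coordinate. [folklore] -/
def IsOddC (i : Fin 3) (w : ℝ³ → F) : Prop :=
  ∀ x, w (reflC i x) = -w x

variable {i : Fin 3} {w : ℝ³ → F}

/-- An odd function vanishes on the mirror. [folklore] -/
theorem IsOddC.eq_zero (h : IsOddC i w) {x : ℝ³} (hx : x i = 0) : w x = 0 := by
  have h1 := h x
  rw [reflC_eq_self hx] at h1
  have h2 : (2 : ℝ) • w x = 0 := by
    rw [two_smul]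
    nth_rewrite 2 [h1]
    exact add_neg_cancel (w x)
  exact (smul_eq_zero.1 h2).resolve_left two_ne_zero

/-- Chain rule for an even function: `Dw(Sx) v = Dw(x) (Sv)`. [folklore] -/
theorem IsEvenC.fderiv_reflC_apply (h : IsEvenC i w) (hw : Differentiable ℝ w) (x v : ℝ³) :
    fderiv ℝ w (reflC i x) v = fderiv ℝ w x (reflC i v) := by
  have h1 := ((hw (reflC i x)).hasFDerivAt.comp x (reflC i).hasFDerivAt).fderiv
  have h2 : (w ∘ reflC i) = w := funext h
  rw [h2] at h1
  rw [h1, ContinuousLinearMap.comp_apply, reflC_reflC]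

/-- Chain rule for an odd function: `Dw(Sx) v = −Dw(x) (Sv)`. [folklore] -/
theorem IsOddC.fderiv_reflC_apply (h : IsOddC i w) (hw : Differentiable ℝ w) (x v : ℝ³) :
    fderiv ℝ w (reflC i x) v = -fderiv ℝ w x (reflC i v) := by
  have h1 := ((hw (reflC i x)).hasFDerivAt.comp x (reflC i).hasFDerivAt).fderiv
  have h2 : (w ∘ reflC i) = fun x => -w x := funext h
  rw [h2, fderiv_fun_neg] at h1
  have h3 := congrArg (fun T : ℝ³ →L[ℝ] F => T (reflC i v)) h1
  simp only [_root_.neg_apply, ContinuousLinearMap.comp_apply, reflC_reflC] at h3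
  rw [← h3]

/-- The derivative of an even function along the reflected coordinate is odd. [folklore] -/
theorem IsEvenC.isOddC_fderiv_apply_same (h : IsEvenC i w) (hw : Differentiable ℝ w) :
    IsOddC i fun x => fderiv ℝ w x (EuclideanSpace.single i 1) := fun x => by
  simp only
  rw [h.fderiv_reflC_apply hw, reflC_single_same, map_neg]

/-- The derivative of an even function along another coordinate is even. [folklore] -/
theorem IsEvenC.isEvenC_fderiv_apply_of_ne (h : IsEvenC i w) (hw : Differentiable ℝ w) {k : Fin 3}
    (hk : k ≠ i) : IsEvenC i fun x => fderiv ℝ w x (EuclideanSpace.single k 1) := fun x => by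
  simp only
  rw [h.fderiv_reflC_apply hw, reflC_single_of_ne hk]

/-- The derivative of an odd function along the reflected coordinate is even. [folklore] -/
theorem IsOddC.isEvenC_fderiv_apply_same (h : IsOddC i w) (hw : Differentiable ℝ w) :
    IsEvenC i fun x => fderiv ℝ w x (EuclideanSpace.single i 1) := fun x => by
  simp only
  rw [h.fderiv_reflC_apply hw, reflC_single_same, map_neg, neg_neg]

/-- The derivative of an odd function along another coordinate is odd. [folklore] -/
theorem IsOddC.isOddC_fderiv_apply_of_ne (h : IsOddC i w) (hw : Differentiable ℝ w) {k : Fin 3}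
    (hk : k ≠ i) : IsOddC i fun x => fderiv ℝ w x (EuclideanSpace.single k 1) := fun x => by
  simp only
  rw [h.fderiv_reflC_apply hw, reflC_single_of_ne hk]

/-- The segment scaling of the Hadamard quotient commutes with the reflection in `x₀`. [folklore] -/
theorem scaleFst_reflC_zero (s : ℝ) (x : ℝ³) : scaleFst s (reflC 0 x) = reflC 0 (scaleFst s x) := by
  ext j
  fin_cases j
  · simp
  · simp [reflC_apply]
  · simp [reflC_apply]

/-- **The Hadamard quotient of an odd function is even** (in the first coordinate). [folklore] -/
theorem IsOddC.isEvenC_hadamardQuotFst {w : ℝ³ → F} (h : IsOddC 0 w) (hw : Differentiable ℝ w) :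
    IsEvenC 0 (hadamardQuotFst w) := fun x => by
  unfold hadamardQuotFst
  refine intervalIntegral.integral_congr fun s _ => ?_
  rw [scaleFst_reflC_zero, h.fderiv_reflC_apply hw, reflC_single_same, map_neg, neg_neg]

/-- The cylindrical radius is invariant under the reflection in `x₀`. [folklore] -/
theorem cylRadius_reflC_zero (x : ℝ³) : cylRadius (reflC 0 x) = cylRadius x := by
  unfold cylRadius
  rw [reflC_apply_same, reflC_apply_of_ne (by decide : (1 : Fin 3) ≠ 0), neg_sq]

/-- The cylindrical radius is invariant under the reflection in `x₁`. [folklore] -/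
theorem cylRadius_reflC_one (x : ℝ³) : cylRadius (reflC 1 x) = cylRadius x := by
  unfold cylRadius
  rw [reflC_apply_same, reflC_apply_of_ne (by decide : (0 : Fin 3) ≠ 1), neg_sq]

/-- **An axisymmetric scalar is even in `x₀`** (it is a function of `(r, z)`,
`MeridianReduction`). [folklore] -/
theorem IsAxisymmetricScalar.isEvenC_zero {α : Type*} [NormedAddCommGroup α] [NormedSpace ℝ α]
    {g : ℝ³ → α} (hg : IsAxisymmetricScalar g) : IsEvenC 0 g := fun x => by
  rw [hg.eq_comp_meridian (reflC 0 x), hg.eq_comp_meridian x, meridian_apply, meridian_apply,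
    cylRadius_reflC_zero, reflC_apply_of_ne (by decide : (2 : Fin 3) ≠ 0)]

/-- **An axisymmetric scalar is even in `x₁`**. [folklore] -/
theorem IsAxisymmetricScalar.isEvenC_one {α : Type*} [NormedAddCommGroup α] [NormedSpace ℝ α]
    {g : ℝ³ → α} (hg : IsAxisymmetricScalar g) : IsEvenC 1 g := fun x => by
  rw [hg.eq_comp_meridian (reflC 1 x), hg.eq_comp_meridian x, meridian_apply, meridian_apply,
    cylRadius_reflC_one, reflC_apply_of_ne (by decide : (2 : Fin 3) ≠ 1)]

end Reflection

/-! ### The horizontal projection of `ℝ⁵` and the meridian point -/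

section Geometry

/-- The horizontal projection of `ℝ⁵`: `P y = y − y₄ e₄` (last coordinate set to `0`). [folklore] -/
def horizProj : ℝ⁵ →L[ℝ] ℝ⁵ :=
  ContinuousLinearMap.id ℝ ℝ⁵ -
    (EuclideanSpace.proj (4 : Fin 5) : ℝ⁵ →L[ℝ] ℝ).smulRight (EuclideanSpace.single 4 (1 : ℝ))

/-- Coordinates of the horizontal projection. [folklore] -/
theorem horizProj_apply (y : ℝ⁵) (i : Fin 5) : horizProj y i = if i = 4 then 0 else y i := by
  simp [horizProj, PiLp.single_apply]
  split_ifs with h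
  · subst h; ring
  · ring

/-- The last coordinate of the horizontal projection vanishes. [folklore] -/
@[simp] theorem horizProj_apply_four (y : ℝ⁵) : horizProj y 4 = 0 := by
  rw [horizProj_apply, if_pos rfl]

/-- The other coordinates are unchanged. [folklore] -/
theorem horizProj_apply_of_ne {i : Fin 5} (hi : i ≠ 4) (y : ℝ⁵) : horizProj y i = y i := by
  rw [horizProj_apply, if_neg hi]

/-- `P e₄ = 0`. [folklore] -/
@[simp] theorem horizProj_single_four : horizProj (EuclideanSpace.single 4 (1 : ℝ)) = 0 := by
  ext j
  rw [horizProj_apply, PiLp.single_apply, PiLp.zero_apply]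
  split_ifs <;> rfl

/-- `P eᵢ = eᵢ` for `i ≠ 4`. [folklore] -/
theorem horizProj_single_of_ne {i : Fin 5} (hi : i ≠ 4) :
    horizProj (EuclideanSpace.single i (1 : ℝ)) = EuclideanSpace.single i (1 : ℝ) := by
  ext j
  rw [horizProj_apply, PiLp.single_apply]
  split_ifs with h1 h2
  · exact absurd (h2.symm.trans h1) hi
  · rfl
  · rfl
  · rfl

/-- `⟪P y, eᵢ⟫ = (P y)ᵢ`. [folklore] -/
theorem inner_horizProj_single (y : ℝ⁵) (i : Fin 5) :
    ⟪horizProj y, EuclideanSpace.single i (1 : ℝ)⟫ = horizProj y i := by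
  rw [EuclideanSpace.inner_single_right, one_mul, conj_trivial]

/-- Every vector splits as `h = P h + h₄ e₄`. [folklore] -/
theorem horizProj_add_smul_single (h : ℝ⁵) :
    horizProj h + h 4 • EuclideanSpace.single 4 (1 : ℝ) = h := by
  ext j
  rw [PiLp.add_apply, PiLp.smul_apply, horizProj_apply, PiLp.single_apply, smul_eq_mul]
  split_ifs with hj
  · subst hj; ring
  · ring

/-- `P` is symmetric and idempotent: `⟪P y, P h⟫ = ⟪P y, h⟫`. [folklore] -/
theorem inner_horizProj_horizProj (y h : ℝ⁵) : ⟪horizProj y, horizProj h⟫ = ⟪horizProj y, h⟫ := by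
  conv_rhs => rw [← horizProj_add_smul_single h]
  rw [inner_add_right, inner_smul_right, inner_horizProj_single, horizProj_apply_four, mul_zero,
    add_zero]

/-- `|P y|² = y₀² + y₁² + y₂² + y₃²`. [folklore] -/
theorem norm_horizProj_sq (y : ℝ⁵) :
    ‖horizProj y‖ ^ 2 = y 0 ^ 2 + y 1 ^ 2 + y 2 ^ 2 + y 3 ^ 2 := by
  rw [EuclideanSpace.real_norm_sq_eq, Fin.sum_univ_five, horizProj_apply_four,
    horizProj_apply_of_ne (by decide), horizProj_apply_of_ne (by decide),
    horizProj_apply_of_ne (by decide), horizProj_apply_of_ne (by decide)]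
  ring

/-- The meridian point of `y ∈ ℝ⁵` in `ℝ³`: `axisPt y = (|P y|, 0, y₄)` (KNSS 2009, p. 9:
`r = √(y₁² + ⋯ + y₄²)`, `y₅ = z`). [cite: KochNadirashviliSereginSverak2009, §5 p. 9 (r = (y₁²+⋯+y₄²)^{1/2}, y₅ = z)] -/
def axisPt (y : ℝ⁵) : ℝ³ :=
  meridianPoint (‖horizProj y‖, y 4)

/-- First coordinate of the meridian point: `r = |P y|`. [folklore] -/
@[simp] theorem axisPt_apply_zero (y : ℝ⁵) : axisPt y 0 = ‖horizProj y‖ := rfl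

/-- Second coordinate of the meridian point: `0`. [folklore] -/
@[simp] theorem axisPt_apply_one (y : ℝ⁵) : axisPt y 1 = 0 := rfl

/-- Third coordinate of the meridian point: `z = y₄`. [folklore] -/
@[simp] theorem axisPt_apply_two (y : ℝ⁵) : axisPt y 2 = y 4 := rfl

/-- `axisPt y = |P y| e₀ + y₄ e₂`. [folklore] -/
theorem axisPt_eq (y : ℝ⁵) :
    axisPt y = ‖horizProj y‖ • EuclideanSpace.single 0 (1 : ℝ) + y 4 • EuclideanSpace.single 2 (1 : ℝ) := by
  ext j
  fin_cases j
  · simp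
  · simp
  · simp

/-- The meridian point depends continuously on `y`. [folklore] -/
theorem continuous_axisPt : Continuous axisPt :=
  (contDiff_meridianPoint (n := 0)).continuous.comp
    (horizProj.continuous.norm.prodMk (EuclideanSpace.proj (4 : Fin 5) : ℝ⁵ →L[ℝ] ℝ).continuous)

/-- **The derivative of `r = |P y|` off the axis**: `D|P·|(y) = ⟪P y, ·⟫ / |P y|`. [folklore] -/
theorem hasFDerivAt_norm_horizProj {y : ℝ⁵} (hy : horizProj y ≠ 0) :
    HasFDerivAt (fun z : ℝ⁵ => ‖horizProj z‖) (‖horizProj y‖⁻¹ • innerSL ℝ (horizProj y)) y := by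
  have h1 : HasFDerivAt (fun z : ℝ⁵ => ‖horizProj z‖ ^ 2)
      (2 • (innerSL ℝ (horizProj y)).comp horizProj) y := horizProj.hasFDerivAt.norm_sq
  have hne : ‖horizProj y‖ ^ 2 ≠ 0 := pow_ne_zero 2 (norm_ne_zero_iff.2 hy)
  have h2 := h1.sqrt hne
  simp only [Real.sqrt_sq (norm_nonneg _)] at h2
  refine h2.congr_fderiv ?_
  ext h
  simp only [_root_.smul_apply, ContinuousLinearMap.comp_apply, innerSL_apply_apply,
    smul_eq_mul, inner_horizProj_horizProj, nsmul_eq_mul, Nat.cast_ofNat]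
  field_simp

/-- The derivative of the meridian point off the axis:
`D(axisPt)(y) h = (⟪P y, h⟫ / |P y|) e₀ + h₄ e₂`. [folklore] -/
def axisDeriv (y : ℝ⁵) : ℝ⁵ →L[ℝ] ℝ³ :=
  (‖horizProj y‖⁻¹ • innerSL ℝ (horizProj y)).smulRight (EuclideanSpace.single 0 (1 : ℝ)) +
    (EuclideanSpace.proj (4 : Fin 5) : ℝ⁵ →L[ℝ] ℝ).smulRight (EuclideanSpace.single 2 (1 : ℝ))

/-- Unfolding `axisDeriv`. [folklore] -/
theorem axisDeriv_apply (y h : ℝ⁵) :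
    axisDeriv y h = (‖horizProj y‖⁻¹ * ⟪horizProj y, h⟫) • EuclideanSpace.single 0 (1 : ℝ) +
      h 4 • EuclideanSpace.single 2 (1 : ℝ) := by
  simp only [axisDeriv, _root_.add_apply, ContinuousLinearMap.smulRight_apply,
    _root_.smul_apply, innerSL_apply_apply, smul_eq_mul, PiLp.proj_apply]

/-- Off the axis the meridian point is differentiable, with derivative `axisDeriv y`. [folklore] -/
theorem hasFDerivAt_axisPt {y : ℝ⁵} (hy : horizProj y ≠ 0) : HasFDerivAt axisPt (axisDeriv y) y := by
  have h : axisPt = fun z : ℝ⁵ =>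
      ‖horizProj z‖ • EuclideanSpace.single 0 (1 : ℝ) + z 4 • EuclideanSpace.single 2 (1 : ℝ) :=
    funext axisPt_eq
  rw [h]
  exact ((hasFDerivAt_norm_horizProj hy).smul_const _).add
    ((EuclideanSpace.proj (4 : Fin 5) : ℝ⁵ →L[ℝ] ℝ).hasFDerivAt.smul_const _)

end Geometry

/-! ### The lift and its first derivative -/

section Lift

/-- The `SO(4)`-invariant lift of `g : ℝ³ → F` to `ℝ⁵`: `liftAx g y = g (|P y|, 0, y₄)` (KNSS 2009,
p. 9: `f̃(y₁, …, y₅) = f(r, z)`). [cite: KochNadirashviliSereginSverak2009, §5 p. 9 (f̃(y₁,…,y₅) = f(r,z))] -/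
def liftAx {α : Type*} (g : ℝ³ → α) (y : ℝ⁵) : α :=
  g (axisPt y)

/-- Unfolding `liftAx`. [folklore] -/
@[simp] theorem liftAx_apply {α : Type*} (g : ℝ³ → α) (y : ℝ⁵) : liftAx g y = g (axisPt y) := rfl

/-- The lift of a continuous function is continuous. [folklore] -/
theorem continuous_liftAx {α : Type*} [TopologicalSpace α] {g : ℝ³ → α} (hg : Continuous g) :
    Continuous (liftAx g) :=
  hg.comp continuous_axisPt

/-- The candidate derivative of the lift of a scalar `g`:
`liftDeriv g y = q(axisPt y) ⟪P y, ·⟫ + ∂₂g(axisPt y) (·)₄` with `q = hadamardQuotFst ∂₀g`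
(so that `r q = ∂₀ g = ∂ᵣ g` on the meridian half-plane). [folklore] -/
def liftDeriv (g : ℝ³ → ℝ) (y : ℝ⁵) : ℝ⁵ →L[ℝ] ℝ :=
  hadamardQuotFst (fun x => fderiv ℝ g x (EuclideanSpace.single 0 1)) (axisPt y) •
      innerSL ℝ (horizProj y) +
    fderiv ℝ g (axisPt y) (EuclideanSpace.single 2 1) • (EuclideanSpace.proj (4 : Fin 5) : ℝ⁵ →L[ℝ] ℝ)

/-- Unfolding `liftDeriv`. [folklore] -/
theorem liftDeriv_apply (g : ℝ³ → ℝ) (y h : ℝ⁵) :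
    liftDeriv g y h =
      hadamardQuotFst (fun x => fderiv ℝ g x (EuclideanSpace.single 0 1)) (axisPt y) * ⟪horizProj y, h⟫ +
        fderiv ℝ g (axisPt y) (EuclideanSpace.single 2 1) * h 4 := by
  simp only [liftDeriv, _root_.add_apply, _root_.smul_apply, innerSL_apply_apply, smul_eq_mul,
    PiLp.proj_apply]

variable {g : ℝ³ → ℝ}

/-- The partial derivative `x ↦ ∂ᵥ g (x)` of a `Cⁿ⁺¹` function is `Cⁿ`. [folklore] -/
theorem contDiff_fderiv_apply_const_succ {n : ℕ∞} {G : Type*} [NormedAddCommGroup G] [NormedSpace ℝ G]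
    {w : ℝ³ → G} (hw : ContDiff ℝ (n + 1) w) (v : ℝ³) : ContDiff ℝ n fun x => fderiv ℝ w x v :=
  (hw.fderiv_right (m := n) (by norm_cast)).clm_apply contDiff_const

/-- The candidate derivative is continuous for `g ∈ C²`. [folklore] -/
theorem continuous_liftDeriv (hg : ContDiff ℝ 2 g) : Continuous (liftDeriv g) := by
  have h0 : ContDiff ℝ 1 fun x => fderiv ℝ g x (EuclideanSpace.single 0 1) :=
    contDiff_fderiv_apply_const_succ (n := 1) (by exact_mod_cast hg) _
  have hq : Continuous (hadamardQuotFst fun x => fderiv ℝ g x (EuclideanSpace.single 0 1)) :=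
    (contDiff_hadamardQuotFst (n := 0) (by exact_mod_cast h0)).continuous
  have h2 : Continuous fun x => fderiv ℝ g x (EuclideanSpace.single 2 1) :=
    (contDiff_fderiv_apply_const_succ (n := 1) (by exact_mod_cast hg) _).continuous
  unfold liftDeriv
  exact ((hq.comp continuous_axisPt).smul ((innerSL ℝ).continuous.comp horizProj.continuous)).add
    ((h2.comp continuous_axisPt).smul continuous_const)

/-- **The derivative of the lift off the axis** (chain rule; the Hadamard factorisation
`∂₀g(x) = x₀ q(x)` turns `⟪P y, h⟫ ∂₀g / |P y|` into `q ⟪P y, h⟫`). [folklore] -/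
theorem hasFDerivAt_liftAx_of_ne (hg : ContDiff ℝ 2 g)
    (h0 : ∀ x : ℝ³, x 0 = 0 → fderiv ℝ g x (EuclideanSpace.single 0 1) = 0) {y : ℝ⁵}
    (hy : horizProj y ≠ 0) : HasFDerivAt (liftAx g) (liftDeriv g y) y := by
  have hg1 : ContDiff ℝ 1 fun x => fderiv ℝ g x (EuclideanSpace.single 0 1) :=
    contDiff_fderiv_apply_const_succ (n := 1) (by exact_mod_cast hg) _
  have hc : HasFDerivAt (liftAx g) ((fderiv ℝ g (axisPt y)).comp (axisDeriv y)) y :=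
    ((hg.differentiable (by norm_num)) (axisPt y)).hasFDerivAt.comp y (hasFDerivAt_axisPt hy)
  refine hc.congr_fderiv ?_
  ext h
  rw [ContinuousLinearMap.comp_apply, axisDeriv_apply, map_add, map_smul, map_smul, liftDeriv_apply,
    smul_eq_mul, smul_eq_mul]
  congr 1
  · -- `∂₀ g (x) = x₀ q (x)` with `x₀ = |P y| ≠ 0`
    have hq := smul_hadamardQuotFst hg1 h0 (axisPt y)
    rw [smul_eq_mul, axisPt_apply_zero] at hq
    rw [← hq]
    have hne : ‖horizProj y‖ ≠ 0 := norm_ne_zero_iff.2 hy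
    field_simp
  · exact mul_comm _ _

/-- **The derivative of the lift** at every point: for `g ∈ C²` with `∂₀ g = 0` on `{x₀ = 0}`,
`D(liftAx g)(y) = liftDeriv g y`; on the axis `{P y = 0}` this is
`hasFDerivAt_of_hasFDerivAt_off_ker`. [folklore] -/
theorem hasFDerivAt_liftAx (hg : ContDiff ℝ 2 g)
    (h0 : ∀ x : ℝ³, x 0 = 0 → fderiv ℝ g x (EuclideanSpace.single 0 1) = 0) (y : ℝ⁵) :
    HasFDerivAt (liftAx g) (liftDeriv g y) y := by
  by_cases hy : horizProj y = 0
  · exact hasFDerivAt_of_hasFDerivAt_off_ker horizProj (continuous_liftAx hg.continuous)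
      (continuous_liftDeriv hg).continuousAt hy
      ⟨EuclideanSpace.single 0 1, by rw [horizProj_single_of_ne (by decide)]; simp⟩
      fun z hz => hasFDerivAt_liftAx_of_ne hg h0 hz
  · exact hasFDerivAt_liftAx_of_ne hg h0 hy

/-- The derivative of the lift. [folklore] -/
theorem fderiv_liftAx (hg : ContDiff ℝ 2 g)
    (h0 : ∀ x : ℝ³, x 0 = 0 → fderiv ℝ g x (EuclideanSpace.single 0 1) = 0) (y : ℝ⁵) :
    fderiv ℝ (liftAx g) y = liftDeriv g y :=
  (hasFDerivAt_liftAx hg h0 y).fderiv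

/-- **The lift is `C¹`** for `g ∈ C²` with `∂₀ g = 0` on `{x₀ = 0}`. [folklore] -/
theorem contDiff_one_liftAx (hg : ContDiff ℝ 2 g)
    (h0 : ∀ x : ℝ³, x 0 = 0 → fderiv ℝ g x (EuclideanSpace.single 0 1) = 0) :
    ContDiff ℝ 1 (liftAx g) :=
  contDiff_one_iff_hasFDerivAt.2 ⟨liftDeriv g, continuous_liftDeriv hg, hasFDerivAt_liftAx hg h0⟩

end Lift

/-! ### Second derivatives: `C²` regularity and the five-dimensional Laplacian -/

section SecondOrder

variable {g : ℝ³ → ℝ}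

/-- The vanishing of `∂₀ g` on `{x₀ = 0}` for `g` even in `x₀`. [folklore] -/
theorem IsEvenC.fderiv_single_zero_eq_zero (hev : IsEvenC 0 g) (hgd : Differentiable ℝ g)
    {x : ℝ³} (hx : x 0 = 0) : fderiv ℝ g x (EuclideanSpace.single 0 1) = 0 :=
  (hev.isOddC_fderiv_apply_same hgd).eq_zero hx

/-- The vanishing of `∂₁ g` on `{x₁ = 0}` for `g` even in `x₁`. [folklore] -/
theorem IsEvenC.fderiv_single_one_eq_zero (hev : IsEvenC 1 g) (hgd : Differentiable ℝ g)
    {x : ℝ³} (hx : x 1 = 0) : fderiv ℝ g x (EuclideanSpace.single 1 1) = 0 :=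
  (hev.isOddC_fderiv_apply_same hgd).eq_zero hx

/-- For `g ∈ C⁴` even in `x₀`: the Hadamard quotient `q = hadamardQuotFst ∂₀g` is `C²` with
`∂₀ q = 0` on `{x₀ = 0}` (it is even), and `∂₂ g` is `C³` with `∂₀∂₂ g = 0` on `{x₀ = 0}`. [folklore] -/
theorem IsEvenC.liftData (hg : ContDiff ℝ 4 g) (hev : IsEvenC 0 g) :
    ContDiff ℝ 2 (hadamardQuotFst fun x => fderiv ℝ g x (EuclideanSpace.single 0 1)) ∧
    (∀ x : ℝ³, x 0 = 0 → fderiv ℝ (hadamardQuotFst fun x => fderiv ℝ g x (EuclideanSpace.single 0 1)) x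
      (EuclideanSpace.single 0 1) = 0) ∧
    ContDiff ℝ 3 (fun x => fderiv ℝ g x (EuclideanSpace.single 2 1)) ∧
    (∀ x : ℝ³, x 0 = 0 → fderiv ℝ (fun x => fderiv ℝ g x (EuclideanSpace.single 2 1)) x
      (EuclideanSpace.single 0 1) = 0) := by
  have hgd : Differentiable ℝ g := hg.differentiable (by norm_num)
  have hg₀ : ContDiff ℝ 3 fun x => fderiv ℝ g x (EuclideanSpace.single 0 1) :=
    contDiff_fderiv_apply_const_succ (n := 3) (by exact_mod_cast hg) _
  have hg₂ : ContDiff ℝ 3 fun x => fderiv ℝ g x (EuclideanSpace.single 2 1) :=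
    contDiff_fderiv_apply_const_succ (n := 3) (by exact_mod_cast hg) _
  have hq : ContDiff ℝ 2 (hadamardQuotFst fun x => fderiv ℝ g x (EuclideanSpace.single 0 1)) :=
    contDiff_hadamardQuotFst (n := 2) (by exact_mod_cast hg₀)
  have hqev : IsEvenC 0 (hadamardQuotFst fun x => fderiv ℝ g x (EuclideanSpace.single 0 1)) :=
    (hev.isOddC_fderiv_apply_same hgd).isEvenC_hadamardQuotFst (hg₀.differentiable (by norm_num))
  have hg₂ev : IsEvenC 0 fun x => fderiv ℝ g x (EuclideanSpace.single 2 1) :=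
    hev.isEvenC_fderiv_apply_of_ne hgd (by decide)
  exact ⟨hq, fun x hx => hqev.fderiv_single_zero_eq_zero (hq.differentiable (by norm_num)) hx, hg₂,
    fun x hx => hg₂ev.fderiv_single_zero_eq_zero (hg₂.differentiable (by norm_num)) hx⟩

/-- **The lift is `C²`** for `g ∈ C⁴` even in `x₀` (in particular for an axisymmetric `C⁴`
scalar, `IsAxisymmetricScalar.isEvenC_zero`): its derivative
`liftDeriv g = (liftAx q) ⟪P ·, ·⟫ + (liftAx ∂₂g) (·)₄` is `C¹` by the first-order theorem applied
to `q` and `∂₂ g`. [folklore] -/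
theorem contDiff_two_liftAx (hg : ContDiff ℝ 4 g) (hev : IsEvenC 0 g) : ContDiff ℝ 2 (liftAx g) := by
  obtain ⟨hq, hq0, hg₂, hg₂0⟩ := hev.liftData hg
  have hgd : Differentiable ℝ g := hg.differentiable (by norm_num)
  have h0 : ∀ x : ℝ³, x 0 = 0 → fderiv ℝ g x (EuclideanSpace.single 0 1) = 0 := fun x hx =>
    hev.fderiv_single_zero_eq_zero hgd hx
  have hLq := contDiff_one_liftAx hq hq0
  have hL₂ := contDiff_one_liftAx (hg₂.of_le (by norm_num)) hg₂0
  have hL : ContDiff ℝ 1 (liftDeriv g) := by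
    rw [contDiff_clm_apply_iff]
    intro h
    have : (fun y => liftDeriv g y h) = fun y =>
        liftAx (hadamardQuotFst fun x => fderiv ℝ g x (EuclideanSpace.single 0 1)) y *
            ⟪horizProj y, h⟫ +
          liftAx (fun x => fderiv ℝ g x (EuclideanSpace.single 2 1)) y * h 4 :=
      funext fun y => liftDeriv_apply g y h
    rw [this]
    exact (hLq.mul (horizProj.contDiff.inner ℝ contDiff_const)).add (hL₂.mul contDiff_const)
  exact contDiff_succ_iff_hasFDerivAt.2 ⟨liftDeriv g, hL, hasFDerivAt_liftAx (hg.of_le (by norm_num)) h0⟩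

/-- The product rule behind `r ∂ᵣ q = ∂ᵣ(∂ᵣ g) − q`: differentiating `x₀ q(x) = ∂₀ g(x)` along
`e₀` gives `x₀ ∂₀q(x) = ∂₀∂₀g(x) − q(x)`. [folklore] -/
theorem mul_fderiv_hadamardQuotFst_eq (hg : ContDiff ℝ 3 g)
    (h0 : ∀ x : ℝ³, x 0 = 0 → fderiv ℝ g x (EuclideanSpace.single 0 1) = 0) (x : ℝ³) :
    x 0 * fderiv ℝ (hadamardQuotFst fun z => fderiv ℝ g z (EuclideanSpace.single 0 1)) x
        (EuclideanSpace.single 0 1) =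
      fderiv ℝ (fun z => fderiv ℝ g z (EuclideanSpace.single 0 1)) x (EuclideanSpace.single 0 1) -
        hadamardQuotFst (fun z => fderiv ℝ g z (EuclideanSpace.single 0 1)) x := by
  have hg₀ : ContDiff ℝ 2 fun z => fderiv ℝ g z (EuclideanSpace.single 0 1) :=
    contDiff_fderiv_apply_const_succ (n := 2) (by exact_mod_cast hg) _
  have hq : ContDiff ℝ 1 (hadamardQuotFst fun z => fderiv ℝ g z (EuclideanSpace.single 0 1)) :=
    contDiff_hadamardQuotFst (n := 1) (by exact_mod_cast hg₀)
  have hH : (fun z : ℝ³ => z 0 * hadamardQuotFst (fun z => fderiv ℝ g z (EuclideanSpace.single 0 1)) z) =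
      fun z => fderiv ℝ g z (EuclideanSpace.single 0 1) := funext fun z => by
    have := smul_hadamardQuotFst (hg₀.of_le (by norm_num)) h0 z
    rwa [smul_eq_mul] at this
  have hc : HasFDerivAt (fun z : ℝ³ => z 0) (EuclideanSpace.proj (0 : Fin 3) : ℝ³ →L[ℝ] ℝ) x :=
    (EuclideanSpace.proj (0 : Fin 3) : ℝ³ →L[ℝ] ℝ).hasFDerivAt
  have h1 := congrArg (fun φ : ℝ³ → ℝ => fderiv ℝ φ x (EuclideanSpace.single 0 1)) hH
  simp only at h1
  rw [fderiv_fun_mul hc.differentiableAt ((hq.differentiable one_ne_zero) x), _root_.add_apply,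
    _root_.smul_apply, _root_.smul_apply, hc.fderiv, PiLp.proj_apply, PiLp.single_apply, if_pos rfl,
    smul_eq_mul, smul_eq_mul, mul_one] at h1
  linarith

/-- **The five-dimensional Laplacian of the lift** (all `y`, including the axis): for `g ∈ C⁴`
even in `x₀`, `Δ(liftAx g)(y) = ∂₀∂₀g(x) + ∂₂∂₂g(x) + 3 q(x)` at `x = axisPt y`,
`q = hadamardQuotFst ∂₀g` (`= ∂ᵣg / r` off the axis): this is KNSS's `f_rr + (3/r) f_r + f_zz`
(p. 9) in a form that makes sense on the axis. [cite: KochNadirashviliSereginSverak2009, §5 p. 9 (Δ_y f̃ = f_rr + (3/r) f_r + f_zz)] -/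
theorem laplacian_liftAx (hg : ContDiff ℝ 4 g) (hev : IsEvenC 0 g) (y : ℝ⁵) :
    (Δ (liftAx g)) y =
      fderiv ℝ (fun x => fderiv ℝ g x (EuclideanSpace.single 0 1)) (axisPt y) (EuclideanSpace.single 0 1) +
      fderiv ℝ (fun x => fderiv ℝ g x (EuclideanSpace.single 2 1)) (axisPt y) (EuclideanSpace.single 2 1) +
      3 * hadamardQuotFst (fun x => fderiv ℝ g x (EuclideanSpace.single 0 1)) (axisPt y) := by
  obtain ⟨hq, hq0, hg₂, hg₂0⟩ := hev.liftData hg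
  have hgd : Differentiable ℝ g := hg.differentiable (by norm_num)
  have h0 : ∀ x : ℝ³, x 0 = 0 → fderiv ℝ g x (EuclideanSpace.single 0 1) = 0 := fun x hx =>
    hev.fderiv_single_zero_eq_zero hgd hx
  set q : ℝ³ → ℝ := hadamardQuotFst fun x => fderiv ℝ g x (EuclideanSpace.single 0 1) with hq_def
  set g₂ : ℝ³ → ℝ := fun x => fderiv ℝ g x (EuclideanSpace.single 2 1) with hg₂_def
  rw [laplacian_eq_sum_fderiv_fderiv (EuclideanSpace.basisFun (Fin 5) ℝ) (contDiff_two_liftAx hg hev) y]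
  simp only [EuclideanSpace.basisFun_apply]
  -- the first partial derivatives of the lift
  have hD : ∀ i : Fin 5, (fun z : ℝ⁵ => fderiv ℝ (liftAx g) z (EuclideanSpace.single i 1)) =
      fun z => q (axisPt z) * horizProj z i + g₂ (axisPt z) * (EuclideanSpace.single i (1 : ℝ) : ℝ⁵) 4 := by
    intro i
    funext z
    rw [fderiv_liftAx (hg.of_le (by norm_num)) h0, liftDeriv_apply, inner_horizProj_single]
  -- pure second derivatives in the horizontal directions
  have hA : ∀ i : Fin 5, i ≠ 4 →
      fderiv ℝ (fun z : ℝ⁵ => fderiv ℝ (liftAx g) z (EuclideanSpace.single i 1)) y (EuclideanSpace.single i 1) =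
        hadamardQuotFst (fun x => fderiv ℝ q x (EuclideanSpace.single 0 1)) (axisPt y) * y i ^ 2 +
          q (axisPt y) := by
    intro i hi
    have hfun : (fun z : ℝ⁵ => fderiv ℝ (liftAx g) z (EuclideanSpace.single i 1)) =
        fun z => liftAx q z * z i := by
      rw [hD i]
      funext z
      rw [horizProj_apply_of_ne hi, PiLp.single_apply, if_neg (Ne.symm hi), mul_zero, add_zero,
        liftAx_apply]
    have hqd : DifferentiableAt ℝ (liftAx q) y :=
      ((contDiff_one_liftAx hq hq0).differentiable one_ne_zero) y
    have hc : HasFDerivAt (fun z : ℝ⁵ => z i) (EuclideanSpace.proj i : ℝ⁵ →L[ℝ] ℝ) y :=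
      (EuclideanSpace.proj i : ℝ⁵ →L[ℝ] ℝ).hasFDerivAt
    rw [hfun, fderiv_fun_mul hqd hc.differentiableAt, _root_.add_apply, _root_.smul_apply,
      _root_.smul_apply, hc.fderiv, PiLp.proj_apply, PiLp.single_apply, if_pos rfl,
      fderiv_liftAx hq hq0, liftDeriv_apply, inner_horizProj_single, horizProj_apply_of_ne hi,
      PiLp.single_apply, if_neg (Ne.symm hi), smul_eq_mul, smul_eq_mul, liftAx_apply]
    ring
  -- the pure second derivative in the axial direction
  have hB : fderiv ℝ (fun z : ℝ⁵ => fderiv ℝ (liftAx g) z (EuclideanSpace.single 4 1)) y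
      (EuclideanSpace.single 4 1) = fderiv ℝ g₂ (axisPt y) (EuclideanSpace.single 2 1) := by
    have hfun : (fun z : ℝ⁵ => fderiv ℝ (liftAx g) z (EuclideanSpace.single 4 1)) = liftAx g₂ := by
      rw [hD 4]
      funext z
      rw [horizProj_apply_four, PiLp.single_apply, if_pos rfl, mul_zero, zero_add, mul_one, liftAx_apply]
    rw [hfun, fderiv_liftAx (hg₂.of_le (by norm_num)) hg₂0, liftDeriv_apply, inner_horizProj_single,
      horizProj_apply_four, PiLp.single_apply, if_pos rfl, mul_zero, zero_add, mul_one]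
  rw [Fin.sum_univ_five, hA 0 (by decide), hA 1 (by decide), hA 2 (by decide), hA 3 (by decide), hB]
  -- `|P y|² Q = |P y| ∂₀q = ∂₀∂₀g − q` at `x = axisPt y`
  have hQ : ‖horizProj y‖ * hadamardQuotFst (fun x => fderiv ℝ q x (EuclideanSpace.single 0 1)) (axisPt y) =
      fderiv ℝ q (axisPt y) (EuclideanSpace.single 0 1) := by
    have := smul_hadamardQuotFst (contDiff_fderiv_apply_const_succ (n := 1) (by exact_mod_cast hq) _) hq0
      (axisPt y)
    rwa [smul_eq_mul, axisPt_apply_zero] at this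
  have hprod : ‖horizProj y‖ * fderiv ℝ q (axisPt y) (EuclideanSpace.single 0 1) =
      fderiv ℝ (fun x => fderiv ℝ g x (EuclideanSpace.single 0 1)) (axisPt y) (EuclideanSpace.single 0 1) -
        q (axisPt y) := by
    have := mul_fderiv_hadamardQuotFst_eq (hg.of_le (by norm_num)) h0 (axisPt y)
    rwa [axisPt_apply_zero] at this
  have hsq := norm_horizProj_sq y
  have hfin : hadamardQuotFst (fun x => fderiv ℝ q x (EuclideanSpace.single 0 1)) (axisPt y) *
      (y 0 ^ 2 + y 1 ^ 2 + y 2 ^ 2 + y 3 ^ 2) =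
      fderiv ℝ (fun x => fderiv ℝ g x (EuclideanSpace.single 0 1)) (axisPt y) (EuclideanSpace.single 0 1) -
        q (axisPt y) := by
    rw [← hsq, sq, ← mul_assoc,
      mul_comm (hadamardQuotFst (fun x => fderiv ℝ q x (EuclideanSpace.single 0 1)) (axisPt y))
        ‖horizProj y‖, hQ, mul_comm, hprod]
  linear_combination hfin

/-- Differentiating the axisymmetry identity `Dg(x)[Jx] = 0` along `e₁` on the meridian plane
`{x₁ = 0}`: `x₀ ∂₁∂₁ g (x) = ∂₀ g (x)` (i.e. `g_θθ / r² = g_r / r`, the angular part of the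
cylindrical Laplacian of an axisymmetric scalar). [folklore] -/
theorem IsAxisymmetricScalar.mul_fderiv_fderiv_single_one (hax : IsAxisymmetricScalar g)
    (hg : ContDiff ℝ 2 g) {x : ℝ³} (hx : x 1 = 0) :
    x 0 * fderiv ℝ (fun z => fderiv ℝ g z (EuclideanSpace.single 1 1)) x (EuclideanSpace.single 1 1) =
      fderiv ℝ g x (EuclideanSpace.single 0 1) := by
  have hgd : Differentiable ℝ g := hg.differentiable (by norm_num)
  have hdg : DifferentiableAt ℝ (fderiv ℝ g) x :=
    ((hg.fderiv_right (m := 1) (by norm_num)).differentiable one_ne_zero) x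
  have hΦ : (fun z : ℝ³ => fderiv ℝ g z (rotGenL z)) = fun _ => (0 : ℝ) := funext fun z => by
    rw [rotGenL_apply]; exact hax.fderiv_rotGen (hgd z)
  have h1 : HasFDerivAt (fun z : ℝ³ => fderiv ℝ g z (rotGenL z))
      ((fderiv ℝ g x).comp rotGenL + (fderiv ℝ (fderiv ℝ g) x).flip (rotGenL x)) x :=
    hdg.hasFDerivAt.clm_apply rotGenL.hasFDerivAt
  have h2 : HasFDerivAt (fun z : ℝ³ => fderiv ℝ g z (rotGenL z)) (0 : ℝ³ →L[ℝ] ℝ) x := by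
    rw [hΦ]; exact hasFDerivAt_const 0 x
  have h3 := congrArg (fun T : ℝ³ →L[ℝ] ℝ => T (EuclideanSpace.single 1 1)) (h1.unique h2)
  simp only [_root_.add_apply, ContinuousLinearMap.comp_apply, ContinuousLinearMap.flip_apply,
    rotGenL_apply, _root_.zero_apply] at h3
  rw [rotGen_single_one, map_neg, rotGen_eq_sub_single, hx, zero_smul, sub_zero, map_smul,
    smul_eq_mul] at h3
  have h4 : fderiv ℝ (fun z => fderiv ℝ g z (EuclideanSpace.single 1 1)) x (EuclideanSpace.single 1 1) =
      fderiv ℝ (fderiv ℝ g) x (EuclideanSpace.single 1 1) (EuclideanSpace.single 1 1) := by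
    rw [fderiv_clm_apply hdg (differentiableAt_const _)]
    simp
  rw [h4]
  linarith

/-- **Off the axis the five-dimensional Laplacian of the lift is KNSS's operator**
`Δ_{ℝ³} g + (2/r) ∂ᵣ g` at the meridian point, in the division-free form
`r² Δ(liftAx g)(y) = r² (Δ g)(x) + 2 (x₀ ∂₀g + x₁ ∂₁g)(x)`, `x = axisPt y`, `r² = x₀² + x₁²`
(valid for all `y`; on the axis both sides vanish) — for an axisymmetric `C⁴` scalar `g`
(KNSS 2009, p. 9: `Δf + (2/r) f_r` "can be interpreted as the 5-dimensional Laplacian").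
[cite: KochNadirashviliSereginSverak2009, §5 p. 9 (Δ + (2/r)∂_r as the 5-dimensional Laplacian)] -/
theorem sq_mul_laplacian_liftAx (hg : ContDiff ℝ 4 g) (hax : IsAxisymmetricScalar g) (y : ℝ⁵) :
    (axisPt y 0 ^ 2 + axisPt y 1 ^ 2) * (Δ (liftAx g)) y =
      (axisPt y 0 ^ 2 + axisPt y 1 ^ 2) * (Δ g) (axisPt y) +
        2 * (axisPt y 0 * fderiv ℝ g (axisPt y) (EuclideanSpace.single 0 1) +
          axisPt y 1 * fderiv ℝ g (axisPt y) (EuclideanSpace.single 1 1)) := by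
  have hev : IsEvenC 0 g := hax.isEvenC_zero
  have hgd : Differentiable ℝ g := hg.differentiable (by norm_num)
  have h0 : ∀ x : ℝ³, x 0 = 0 → fderiv ℝ g x (EuclideanSpace.single 0 1) = 0 := fun x hx =>
    hev.fderiv_single_zero_eq_zero hgd hx
  rw [laplacian_liftAx hg hev y,
    laplacian_eq_sum_fderiv_fderiv (EuclideanSpace.basisFun (Fin 3) ℝ) (hg.of_le (by norm_num)) (axisPt y)]
  simp only [EuclideanSpace.basisFun_apply, Fin.sum_univ_three, axisPt_apply_one]
  have h11 := hax.mul_fderiv_fderiv_single_one (hg.of_le (by norm_num)) (axisPt_apply_one y)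
  have hq := smul_hadamardQuotFst (contDiff_fderiv_apply_const_succ (n := 1)
    (by exact_mod_cast (hg.of_le (by norm_num) : ContDiff ℝ 2 g)) _) h0 (axisPt y)
  rw [smul_eq_mul] at hq
  linear_combination (-(axisPt y 0)) * h11 + (3 * axisPt y 0) * hq

end SecondOrder

/-! ### The drift term, sup bounds, continuity in parameters -/

section Consequences

variable {g : ℝ³ → ℝ}

/-- **The drift identity**: for the drift `a = u₀ P y/|P y| + u₂ e₄` built from a vector
`u ∈ ℝ³` (radial component `u₀`, axial component `u₂` at the meridian point),
`D(liftAx g)(y)[a] = Dg(axisPt y)[u]` provided `∂₀ g = 0` on `{x₀ = 0}` and `∂₁ g = 0` on the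
meridian plane `{x₁ = 0}` (both hold for axisymmetric `g`): this is
`u_r f_r + u_z f_z = (ũ·∇_y) f̃` (KNSS (5.10)/(2.1)). [cite: KochNadirashviliSereginSverak2009, §5 (5.10) p. 9] -/
theorem liftDeriv_apply_drift (hg : ContDiff ℝ 2 g)
    (h0 : ∀ x : ℝ³, x 0 = 0 → fderiv ℝ g x (EuclideanSpace.single 0 1) = 0)
    (h1 : ∀ x : ℝ³, x 1 = 0 → fderiv ℝ g x (EuclideanSpace.single 1 1) = 0) (y : ℝ⁵) (u : ℝ³) :
    liftDeriv g y (u 0 • (‖horizProj y‖⁻¹ • horizProj y) + u 2 • EuclideanSpace.single 4 (1 : ℝ)) =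
      fderiv ℝ g (axisPt y) u := by
  rw [liftDeriv_apply]
  have hi : ⟪horizProj y, u 0 • (‖horizProj y‖⁻¹ • horizProj y) + u 2 • EuclideanSpace.single 4 (1 : ℝ)⟫ =
      u 0 * ‖horizProj y‖ := by
    rw [inner_add_right, inner_smul_right, inner_smul_right, real_inner_self_eq_norm_sq,
      inner_smul_right, inner_horizProj_single, horizProj_apply_four, mul_zero, add_zero]
    by_cases hρ : ‖horizProj y‖ = 0
    · rw [hρ]; simp
    · field_simp
  have h4 : (u 0 • (‖horizProj y‖⁻¹ • horizProj y) + u 2 • EuclideanSpace.single 4 (1 : ℝ) : ℝ⁵) 4 = u 2 := by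
    rw [PiLp.add_apply, PiLp.smul_apply, PiLp.smul_apply, horizProj_apply_four, PiLp.smul_apply,
      PiLp.single_apply, if_pos rfl]
    simp
  rw [hi, h4]
  have hu : u = u 0 • EuclideanSpace.single 0 (1 : ℝ) + u 1 • EuclideanSpace.single 1 (1 : ℝ) +
      u 2 • EuclideanSpace.single 2 (1 : ℝ) := by
    ext j
    fin_cases j <;> simp
  conv_rhs => rw [hu]
  rw [map_add, map_add, map_smul, map_smul, map_smul, smul_eq_mul, smul_eq_mul, smul_eq_mul,
    h1 _ (axisPt_apply_one y), mul_zero, add_zero]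
  have hq := smul_hadamardQuotFst (contDiff_fderiv_apply_const_succ (n := 1) (by exact_mod_cast hg) _) h0
    (axisPt y)
  rw [smul_eq_mul, axisPt_apply_zero] at hq
  rw [← hq]
  ring

/-- A directional derivative is bounded by the operator norm (unit coordinate vectors). [folklore] -/
theorem abs_fderiv_apply_single_le {w : ℝ³ → ℝ} (x : ℝ³) (i : Fin 3) :
    |fderiv ℝ w x (EuclideanSpace.single i 1)| ≤ ‖fderiv ℝ w x‖ := by
  have h := (fderiv ℝ w x).le_opNorm (EuclideanSpace.single i (1 : ℝ))
  rwa [PiLp.norm_single, norm_one, mul_one, Real.norm_eq_abs] at h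

/-- **Sup bound for the gradient of the lift**: `‖D(liftAx g)(y)‖ ≤ 2 sup ‖Dg‖`
(`|q| |P y| = |∂₀ g|`). [folklore] -/
theorem norm_liftDeriv_le (hg : ContDiff ℝ 2 g)
    (h0 : ∀ x : ℝ³, x 0 = 0 → fderiv ℝ g x (EuclideanSpace.single 0 1) = 0) {B : ℝ}
    (hB : ∀ x, ‖fderiv ℝ g x‖ ≤ B) (y : ℝ⁵) : ‖liftDeriv g y‖ ≤ 2 * B := by
  have hB0 : 0 ≤ B := (norm_nonneg _).trans (hB 0)
  refine ContinuousLinearMap.opNorm_le_bound _ (by positivity) fun h => ?_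
  rw [liftDeriv_apply, Real.norm_eq_abs]
  have hq := smul_hadamardQuotFst (contDiff_fderiv_apply_const_succ (n := 1) (by exact_mod_cast hg) _) h0
    (axisPt y)
  rw [smul_eq_mul, axisPt_apply_zero] at hq
  have e1 : |hadamardQuotFst (fun x => fderiv ℝ g x (EuclideanSpace.single 0 1)) (axisPt y) *
      ⟪horizProj y, h⟫| ≤ B * ‖h‖ := by
    rw [abs_mul]
    calc |hadamardQuotFst (fun x => fderiv ℝ g x (EuclideanSpace.single 0 1)) (axisPt y)| * |⟪horizProj y, h⟫|
        ≤ |hadamardQuotFst (fun x => fderiv ℝ g x (EuclideanSpace.single 0 1)) (axisPt y)| *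
            (‖horizProj y‖ * ‖h‖) := by gcongr; exact abs_real_inner_le_norm _ _
      _ = |‖horizProj y‖ * hadamardQuotFst (fun x => fderiv ℝ g x (EuclideanSpace.single 0 1))
            (axisPt y)| * ‖h‖ := by rw [abs_mul, abs_of_nonneg (norm_nonneg _)]; ring
      _ ≤ B * ‖h‖ := by
          rw [hq]; gcongr; exact (abs_fderiv_apply_single_le _ _).trans (hB _)
  have e2 : |fderiv ℝ g (axisPt y) (EuclideanSpace.single 2 1) * h 4| ≤ B * ‖h‖ := by
    rw [abs_mul]
    have h4 : |h 4| ≤ ‖h‖ := by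
      have := PiLp.norm_apply_le h 4
      rwa [Real.norm_eq_abs] at this
    gcongr
    exact (abs_fderiv_apply_single_le _ _).trans (hB _)
  calc _ ≤ _ := abs_add_le _ _
    _ ≤ B * ‖h‖ + B * ‖h‖ := add_le_add e1 e2
    _ = 2 * B * ‖h‖ := by ring

/-- **Sup bound for the Laplacian of the lift**: `|Δ(liftAx g)| ≤ 5 sup ‖D²g‖` (from
`laplacian_liftAx`: `|∂₀∂₀g|, |∂₂∂₂g| ≤ sup ‖D²g‖`, `|q| ≤ sup ‖D ∂₀g‖`). [folklore] -/
theorem abs_laplacian_liftAx_le (hg : ContDiff ℝ 4 g) (hev : IsEvenC 0 g) {B : ℝ}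
    (hB : ∀ (i : Fin 3) (x : ℝ³), ‖fderiv ℝ (fun z => fderiv ℝ g z (EuclideanSpace.single i 1)) x‖ ≤ B)
    (y : ℝ⁵) : |(Δ (liftAx g)) y| ≤ 5 * B := by
  rw [laplacian_liftAx hg hev y]
  have e00 := (abs_fderiv_apply_single_le (w := fun z => fderiv ℝ g z (EuclideanSpace.single 0 1))
    (axisPt y) 0).trans (hB 0 _)
  have e22 := (abs_fderiv_apply_single_le (w := fun z => fderiv ℝ g z (EuclideanSpace.single 2 1))
    (axisPt y) 2).trans (hB 2 _)
  have eq : |hadamardQuotFst (fun x => fderiv ℝ g x (EuclideanSpace.single 0 1)) (axisPt y)| ≤ B := by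
    have := norm_hadamardQuotFst_le (w := fun x => fderiv ℝ g x (EuclideanSpace.single 0 1)) (hB 0)
      (axisPt y)
    rwa [Real.norm_eq_abs] at this
  calc _ ≤ |fderiv ℝ (fun x => fderiv ℝ g x (EuclideanSpace.single 0 1)) (axisPt y) (EuclideanSpace.single 0 1) +
        fderiv ℝ (fun x => fderiv ℝ g x (EuclideanSpace.single 2 1)) (axisPt y) (EuclideanSpace.single 2 1)| +
        |3 * hadamardQuotFst (fun x => fderiv ℝ g x (EuclideanSpace.single 0 1)) (axisPt y)| :=
        abs_add_le _ _
    _ ≤ (B + B) + 3 * B := by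
        refine add_le_add ((abs_add_le _ _).trans (add_le_add e00 e22)) ?_
        rw [abs_mul, abs_of_pos (by norm_num : (0 : ℝ) < 3)]
        gcongr
    _ = 5 * B := by ring

/-- The value bound: `|liftAx g| ≤ sup |g|`. [folklore] -/
theorem abs_liftAx_le {B : ℝ} (hB : ∀ x, |g x| ≤ B) (y : ℝ⁵) : |liftAx g y| ≤ B :=
  hB _

variable {X : Type*} [TopologicalSpace X]

/-- **Continuity of the derivative of the lift in a parameter**: if `(p, x) ↦ ∂₀∂₀ (w p)(x)` and
`(p, x) ↦ ∂₂ (w p)(x)` are continuous, so is `(p, y) ↦ liftDeriv (w p) y`. [folklore] -/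
theorem continuous_liftDeriv_param {w : X → ℝ³ → ℝ}
    (h00 : Continuous fun q : X × ℝ³ =>
      fderiv ℝ (fun z => fderiv ℝ (w q.1) z (EuclideanSpace.single 0 1)) q.2 (EuclideanSpace.single 0 1))
    (h2 : Continuous fun q : X × ℝ³ => fderiv ℝ (w q.1) q.2 (EuclideanSpace.single 2 1)) :
    Continuous fun q : X × ℝ⁵ => liftDeriv (w q.1) q.2 := by
  have hq : Continuous fun q : X × ℝ³ =>
      hadamardQuotFst (fun z => fderiv ℝ (w q.1) z (EuclideanSpace.single 0 1)) q.2 :=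
    continuous_hadamardQuotFst_param (w := fun p z => fderiv ℝ (w p) z (EuclideanSpace.single 0 1)) h00
  have hax : Continuous fun q : X × ℝ⁵ => (q.1, axisPt q.2) :=
    continuous_fst.prodMk (continuous_axisPt.comp continuous_snd)
  unfold liftDeriv
  exact ((hq.comp hax).smul ((innerSL ℝ).continuous.comp (horizProj.continuous.comp continuous_snd))).add
    ((h2.comp hax).smul continuous_const)

/-- **Continuity of the Laplacian of the lift in a parameter**: if every `w p` is `C⁴` and even
in `x₀`, and `(p, x) ↦ ∂₀∂₀ (w p)(x)`, `(p, x) ↦ ∂₂∂₂ (w p)(x)` are continuous, then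
`(p, y) ↦ Δ(liftAx (w p))(y)` is continuous. [folklore] -/
theorem continuous_laplacian_liftAx_param {w : X → ℝ³ → ℝ} (hw : ∀ p, ContDiff ℝ 4 (w p))
    (hev : ∀ p, IsEvenC 0 (w p))
    (h00 : Continuous fun q : X × ℝ³ =>
      fderiv ℝ (fun z => fderiv ℝ (w q.1) z (EuclideanSpace.single 0 1)) q.2 (EuclideanSpace.single 0 1))
    (h22 : Continuous fun q : X × ℝ³ =>
      fderiv ℝ (fun z => fderiv ℝ (w q.1) z (EuclideanSpace.single 2 1)) q.2 (EuclideanSpace.single 2 1)) :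
    Continuous fun q : X × ℝ⁵ => (Δ (liftAx (w q.1))) q.2 := by
  have hq : Continuous fun q : X × ℝ³ =>
      hadamardQuotFst (fun z => fderiv ℝ (w q.1) z (EuclideanSpace.single 0 1)) q.2 :=
    continuous_hadamardQuotFst_param (w := fun p z => fderiv ℝ (w p) z (EuclideanSpace.single 0 1)) h00
  have hax : Continuous fun q : X × ℝ⁵ => (q.1, axisPt q.2) :=
    continuous_fst.prodMk (continuous_axisPt.comp continuous_snd)
  have heq : (fun q : X × ℝ⁵ => (Δ (liftAx (w q.1))) q.2) = fun q =>
      fderiv ℝ (fun x => fderiv ℝ (w q.1) x (EuclideanSpace.single 0 1)) (axisPt q.2) (EuclideanSpace.single 0 1) +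
      fderiv ℝ (fun x => fderiv ℝ (w q.1) x (EuclideanSpace.single 2 1)) (axisPt q.2) (EuclideanSpace.single 2 1) +
      3 * hadamardQuotFst (fun x => fderiv ℝ (w q.1) x (EuclideanSpace.single 0 1)) (axisPt q.2) :=
    funext fun q => laplacian_liftAx (hw q.1) (hev q.1) q.2
  rw [heq]
  exact ((h00.comp hax).add (h22.comp hax)).add (continuous_const.mul (hq.comp hax))

end Consequences

end Literature.Analysis.FluidPDE

end
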